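import Literature.MathematicalPhysics.QuantumManyBody.PeriodicBoseGasTagged
import Literature.MathematicalPhysics.QuantumManyBody.PeriodicBoseGasMomentumSector
import HarnessLib

/-!
# Route `BECProbeMassFlow`, crux `RecoilTransfer` (stmt-AtomisticToContinuum-12311):
# stub `stub_zeroMomentumDescent`

Support file for the crux `RecoilTransfer` (route `BECProbeMassFlow`, line `registered`, skeleton
`Lines/birth.lean` v2): the stub `stub_zeroMomentumDescent` (exact registered name and signature),
the **zero-momentum descent** — converse of `BECProbeMassFlowRecoilTransferZeroMomentumLift.lean`.
A tagged state `Ψ` (`N` bath bosons, one tagged particle `x₀`, torus `ℝ³/Lℤ³`) of total momentum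
`0` (`HasTotalMomentum 0 Ψ.ψ`: invariant under the simultaneous translation of all particles) IS a
lifted pinned-scatterer state, `Ψ(x₀, Y) = Ψ(0, Y - x₀𝟙) = L^{-3/2} Φ(Y - x₀𝟙)` with the **bath
function** `Φ(Z) = √(L³) Ψ(0, Z)`, and: `Φ` is an admissible pinned trial state
(`zeroMomentumDescent_exists`: `C¹`, periodic, Bose-symmetric by the bath symmetry of `Ψ`,
normalised by Tonelli with the tagged coordinate outermost and the shift of the fundamental cell);
`⟨Φ, (H + ∑ⱼ v^per(xⱼ)) Φ⟩ ≤ ⟨Ψ, H_κ Ψ⟩` for every `κ` (`impurityPeriodicEnergy_descent_le`: drop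
`κ|∇₀Ψ|² ≥ 0`; slice by slice the bath gradients of `Ψ` are those of `L^{-3/2}Φ` at `Y - x𝟙` —
chain rule through the linear map `X ↦ (x₁ - x₀, …)` — and the potential is the pinned one there);
and `∫_{[0,L)^{3N}} |∫_{[0,L)³} Φ(X + t𝟙) dt|² dX = L⁶ · taggedZeroModeOccupation N L Ψ`
(`lintegral_sq_setIntegral_descent`: `Φ(X + t𝟙) = √(L³) Ψ(-t, X)`, and the cell integral of the
`Lℤ³`-periodic `t ↦ Ψ(t, X)` is **reflection invariant** — `setIntegral_cell_comp_neg`, by Mathlib's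
fundamental-domain calculus: `-[0,L)³` is again a fundamental domain of `Lℤ³`).
Elementary; every `v ≥ 0` (hard cores included), every `κ : ℝ`, every `N`.
-/

noncomputable section

open MeasureTheory
open scoped ENNReal NNReal

namespace Summit.AtomisticToContinuum.BoseEinsteinCondensation.Theorems

open Literature.MathematicalPhysics.QuantumManyBody.BoseGas

variable {N : ℕ} {L : ℝ}

/-! ### Reflection invariance of cell integrals of periodic functions -/

/-- **Reflection of the fundamental cell.** For `f : ℝ³ → ℂ` periodic under `Lℤ³` (`0 < L`),
`∫_{[0,L)³} f(-x) dx = ∫_{[0,L)³} f(x) dx`: `[0,L)³` is the `ZSpan.fundamentalDomain` of the basis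
`(L e_k)` spanning `Lℤ³` over `ℤ`, Lebesgue measure is reflection invariant, the reflected cell
`-[0,L)³` is again a fundamental domain of `Lℤ³`, and integrals of `Lℤ³`-invariant functions over
two fundamental domains agree. [folklore] -/
theorem setIntegral_cell_comp_neg (hL : 0 < L) {f : Space → ℂ}
    (hf : ∀ (x : Space) (k : Fin 3), f (x + EuclideanSpace.single k L) = f x) :
    ∫ x in cell L, f (-x) = ∫ x in cell L, f x := by
  -- the basis `(L e_k)_k` of `ℝ³`; its `ℤ`-span is the period lattice `Lℤ³`
  set b : Module.Basis (Fin 3) ℝ Space := (EuclideanSpace.basisFun (Fin 3) ℝ).toBasis.unitsSMul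
    fun _ : Fin 3 => Units.mk0 L hL.ne' with hb
  have hbk : ∀ k, b k = EuclideanSpace.single k L := fun k => by
    rw [hb, Module.Basis.unitsSMul_apply, ← smul_single_one]
    simp [Units.smul_def]
  -- its fundamental domain is the cell `[0,L)³` (coordinates `L⁻¹ xₖ`)
  have hdom : ZSpan.fundamentalDomain b = cell L := by
    ext x
    have hr : ∀ k, b.repr x k = L⁻¹ * x k := fun k => by simp [hb, Units.smul_def]
    simp only [ZSpan.mem_fundamentalDomain, hr, Set.mem_Ico, cell, Set.mem_setOf_eq]
    refine forall_congr' fun k => ?_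
    rw [← div_eq_inv_mul, le_div_iff₀ hL, div_lt_iff₀ hL, zero_mul, one_mul]
  set Γ := (Submodule.span ℤ (Set.range b)).toAddSubgroup
  haveI : Countable Γ := inferInstanceAs (Countable (Submodule.span ℤ (Set.range b)))
  -- `f` is invariant under `Γ = Lℤ³` (induction over the subgroup closure of the generators)
  have hinv : ∀ (g : Γ) (x : Space), f (g +ᵥ x) = f x := by
    rintro ⟨g, hg⟩ x
    show f (g + x) = f x
    replace hg : g ∈ AddSubgroup.closure (Set.range b) := by
      rwa [← Submodule.span_int_eq_addSubgroupClosure]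
    induction hg using AddSubgroup.closure_induction generalizing x with
    | mem v hv =>
        obtain ⟨k, rfl⟩ := hv
        rw [hbk, add_comm]
        exact hf x k
    | zero => rw [zero_add]
    | add v w _ _ ihv ihw => rw [add_assoc, ihv, ihw]
    | neg v _ ihv =>
        have h := ihv (-v + x)
        rw [← add_assoc, add_neg_cancel, zero_add] at h
        exact h.symm
  have hF : IsAddFundamentalDomain Γ (cell L) volume := by
    rw [← hdom]
    exact ZSpan.isAddFundamentalDomain' _ _
  have hneg : MeasurePreserving (Neg.neg : Space → Space) volume volume :=
    Measure.measurePreserving_neg _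
  -- the reflected cell `-[0,L)³` is a fundamental domain as well
  have hF' : IsAddFundamentalDomain Γ ((Equiv.neg Space) '' cell L) volume := by
    refine hF.image_of_equiv (Equiv.neg Space) ?_ (Equiv.neg Γ) fun g x => ?_
    · rw [Equiv.neg_symm]
      exact hneg.quasiMeasurePreserving
    · simp only [Equiv.neg_apply, AddSubgroup.vadd_def, vadd_eq_add, neg_add_rev,
        AddSubgroup.coe_neg, neg_neg, add_comm]
  calc ∫ x in cell L, f (-x) = ∫ x in (Neg.neg : Space → Space) '' cell L, f x :=
        (hneg.setIntegral_image_emb (MeasurableEquiv.neg Space).measurableEmbedding f (cell L)).symm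
    _ = ∫ x in cell L, f x := hF'.setIntegral_eq hF hinv

/-! ### Total momentum zero and the bath function `Φ(Z) = √(L³) Ψ(0, Z)` -/

/-- Total momentum `0`: `ψ(x, Y) = ψ(0, Y - x𝟙)` (translate all particles by `-x`). [folklore] -/
private theorem apply_vecCons_eq {ψ : Config (N + 1) → ℂ} (hQ : HasTotalMomentum 0 ψ) (x : Space)
    (Y : Config N) : ψ (Matrix.vecCons x Y) = ψ (Matrix.vecCons 0 (Y + fun _ => -x)) := by
  have h : (fun i => (Matrix.vecCons x Y : Config (N + 1)) i + -x) =
      Matrix.vecCons 0 (Y + fun _ => -x) := by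
    funext i
    refine Fin.cases ?_ (fun l => ?_) i
    · simp only [Matrix.cons_val_zero, add_neg_cancel]
    · simp only [Matrix.cons_val_succ, Pi.add_apply]
  rw [← hasTotalMomentum_zero_iff.1 hQ (-x) (Matrix.vecCons x Y), h]

/-- Total momentum `0`: `ψ(X) = ψ(0, x₁ - x₀, …, x_N - x₀)` (translate by `-x₀`). [folklore] -/
private theorem apply_eq_vecCons_rel {ψ : Config (N + 1) → ℂ} (hQ : HasTotalMomentum 0 ψ)
    (X : Config (N + 1)) : ψ X = ψ (Matrix.vecCons 0 (fun j => X j.succ - X 0)) := by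
  have h : (fun i => X i + -X 0) = Matrix.vecCons 0 (fun j => X j.succ - X 0) := by
    funext i
    refine Fin.cases ?_ (fun l => ?_) i
    · simp only [Matrix.cons_val_zero, add_neg_cancel]
    · simp only [Matrix.cons_val_succ, sub_eq_add_neg]
  rw [← h, hasTotalMomentum_zero_iff.1 hQ]

/-- The bath function is `Lℤ³`-periodic in every bath particle: `(0, Z + u eⱼ) = (0, Z) + u eⱼ₊₁`
and `Ψ` is periodic in the particle `j + 1`. [folklore] -/
private theorem bath_periodic (Ψ : TaggedPeriodicTrialState N L) (c : ℂ) (Z : Config N)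
    (j : Fin N) (k : Fin 3) :
    c * Ψ.ψ (Matrix.vecCons 0 (Z + Pi.single j (EuclideanSpace.single k L))) =
      c * Ψ.ψ (Matrix.vecCons 0 Z) := by
  have h : (Matrix.vecCons 0 (Z + Pi.single j (EuclideanSpace.single k L)) : Config (N + 1)) =
      Matrix.vecCons 0 Z + Pi.single j.succ (EuclideanSpace.single k L) := by
    funext i
    refine Fin.cases ?_ (fun l => ?_) i
    · simp only [Matrix.cons_val_zero, Pi.add_apply, Pi.single_eq_of_ne' (Fin.succ_ne_zero j),
        add_zero]
    · simp only [Matrix.cons_val_succ, Pi.add_apply, Pi.single_apply, Fin.succ_inj]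
  rw [h, Ψ.periodic]

/-- **A tagged state of total momentum `0` is the lift of its bath function**: if
`Φ(Z) = √(L³) Ψ(0, Z)` then `Ψ(X) = (√(L³))⁻¹ Φ(x₁ - x₀, …, x_N - x₀)`. [folklore] -/
theorem eq_lift_of_hasTotalMomentum_zero (Ψ : TaggedPeriodicTrialState N L)
    (hQ : HasTotalMomentum 0 Ψ.ψ) {Φ : PeriodicTrialState N L}
    (hΦ : Φ.ψ = fun Z => ((Real.sqrt (L ^ 3) : ℝ) : ℂ) * Ψ.ψ (Matrix.vecCons 0 Z)) :
    Ψ.ψ = fun X => ((Real.sqrt (L ^ 3))⁻¹ : ℂ) * Φ.ψ (fun j => X j.succ - X 0) := by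
  have hc : ((Real.sqrt (L ^ 3) : ℝ) : ℂ) ≠ 0 :=
    Complex.ofReal_ne_zero.2 (Real.sqrt_pos.2 (pow_pos Ψ.side_pos 3)).ne'
  funext X
  simp only [hΦ]
  rw [← mul_assoc, inv_mul_cancel₀ hc, one_mul]
  exact apply_eq_vecCons_rel hQ X

/-- **Normalisation of the bath function**, `∫_{[0,L)^{3N}} |√(L³) Ψ(0, Z)|² dZ = 1`: Tonelli with
the tagged coordinate outermost; on the slice `x₀ = x`, `|Ψ(x, Y)|² = L⁻³ |√(L³) Ψ(0, Y - x𝟙)|²`,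
then shift the fundamental cell. [folklore] -/
private theorem lintegral_normSq_bath (Ψ : TaggedPeriodicTrialState N L)
    (hQ : HasTotalMomentum 0 Ψ.ψ) :
    ∫⁻ Z in cellN N L,
      (‖((Real.sqrt (L ^ 3) : ℝ) : ℂ) * Ψ.ψ (Matrix.vecCons 0 Z)‖₊ : ℝ≥0∞) ^ 2 = 1 := by
  have hL := Ψ.side_pos
  have hL3 : ENNReal.ofReal L ^ 3 ≠ 0 := pow_ne_zero _ (ENNReal.ofReal_pos.2 hL).ne'
  have hL3' : ENNReal.ofReal L ^ 3 ≠ ⊤ := ENNReal.pow_ne_top ENNReal.ofReal_ne_top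
  have hc : ((Real.sqrt (L ^ 3) : ℝ) : ℂ) ≠ 0 :=
    Complex.ofReal_ne_zero.2 (Real.sqrt_pos.2 (pow_pos hL 3)).ne'
  have hslice : ∀ x : Space, ∫⁻ Y in cellN N L, (‖Ψ.ψ (Matrix.vecCons x Y)‖₊ : ℝ≥0∞) ^ 2 =
      (ENNReal.ofReal L ^ 3)⁻¹ * ∫⁻ Z in cellN N L,
        (‖((Real.sqrt (L ^ 3) : ℝ) : ℂ) * Ψ.ψ (Matrix.vecCons 0 Z)‖₊ : ℝ≥0∞) ^ 2 := by
    intro x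
    have hper : ∀ (Z : Config N) (i : Fin N) (k : Fin 3), (‖((Real.sqrt (L ^ 3) : ℝ) : ℂ) *
          Ψ.ψ (Matrix.vecCons 0 (Z + Pi.single i (EuclideanSpace.single k L)))‖₊ : ℝ≥0∞) ^ 2 =
        (‖((Real.sqrt (L ^ 3) : ℝ) : ℂ) * Ψ.ψ (Matrix.vecCons 0 Z)‖₊ : ℝ≥0∞) ^ 2 :=
      fun Z i k => by rw [bath_periodic]
    have hpt : ∀ Y : Config N, (‖Ψ.ψ (Matrix.vecCons x Y)‖₊ : ℝ≥0∞) ^ 2 =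
        (‖((Real.sqrt (L ^ 3))⁻¹ : ℂ)‖₊ : ℝ≥0∞) ^ 2 * (‖((Real.sqrt (L ^ 3) : ℝ) : ℂ) *
          Ψ.ψ (Matrix.vecCons 0 (Y + fun _ => -x))‖₊ : ℝ≥0∞) ^ 2 := fun Y => by
      rw [← mul_pow, ← ENNReal.coe_mul, ← nnnorm_mul, ← mul_assoc, inv_mul_cancel₀ hc, one_mul,
        ← apply_vecCons_eq hQ]
    simp only [hpt]
    rw [lintegral_const_mul' _ _ (ENNReal.pow_ne_top ENNReal.coe_ne_top),
      lintegral_cellN_comp_add hL (G := fun Z => (‖((Real.sqrt (L ^ 3) : ℝ) : ℂ) *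
        Ψ.ψ (Matrix.vecCons 0 Z)‖₊ : ℝ≥0∞) ^ 2) hper (fun _ => -x), nnnorm_constantMode_sq hL]
  have h1 := Ψ.norm_eq
  rw [setLIntegral_cellN_succ_left
    ((Ψ.contDiff.continuous.measurable.nnnorm.coe_nnreal_ennreal).pow_const _)] at h1
  simp only [hslice] at h1
  rwa [setLIntegral_const, volume_cell, mul_right_comm, ENNReal.inv_mul_cancel hL3 hL3',
    one_mul] at h1

/-- **The bath function is an admissible pinned trial state.** For a tagged state `Ψ` of total
momentum `0`, `Φ(Z) = √(L³) Ψ(0, Z)` is a `PeriodicTrialState N L` (`C¹` — `Z ↦ (0, Z)` is affine;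
periodic; Bose-symmetric by the bath symmetry of `Ψ`; normalised). [folklore] -/
theorem zeroMomentumDescent_exists (Ψ : TaggedPeriodicTrialState N L)
    (hQ : HasTotalMomentum 0 Ψ.ψ) : ∃ Φ : PeriodicTrialState N L,
      Φ.ψ = fun Z => ((Real.sqrt (L ^ 3) : ℝ) : ℂ) * Ψ.ψ (Matrix.vecCons 0 Z) :=
  ⟨{ ψ := fun Z => ((Real.sqrt (L ^ 3) : ℝ) : ℂ) * Ψ.ψ (Matrix.vecCons 0 Z)
     contDiff := contDiff_const.mul (Ψ.contDiff.comp (contDiff_pi.2 fun i => Fin.cases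
       (by simp only [Matrix.cons_val_zero]; exact contDiff_const)
       (fun j => by simp only [Matrix.cons_val_succ]; exact contDiff_apply ℝ Space j) i))
     periodic := fun Z i k => bath_periodic Ψ _ Z i k
     symm := fun σ Z => by simp only [Ψ.symm_vecCons]
     norm_eq := lintegral_normSq_bath Ψ hQ }, rfl⟩

/-! ### The energy and the occupation -/

/-- Bath derivatives of the lift `X ↦ c f(x₁ - x₀, …, x_N - x₀)` (chain rule through the linear
relative-coordinate map, which sends `u e_{j+1}` to `u e_j`). [folklore] -/
private theorem fderiv_relLift_single_succ {f : Config N → ℂ} (hf : Differentiable ℝ f) (c : ℂ)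
    (X : Config (N + 1)) (j : Fin N) (u : Space) :
    fderiv ℝ (fun X : Config (N + 1) => c * f (fun j => X j.succ - X 0)) X (Pi.single j.succ u) =
      c * fderiv ℝ f (fun j => X j.succ - X 0) (Pi.single j u) := by
  -- adapted from BECProbeMassFlowRecoilTransferZeroMomentumLift.lean (`fderiv_lift_single_succ`)
  set A : Config (N + 1) →L[ℝ] Config N := ContinuousLinearMap.pi fun j : Fin N =>
    (ContinuousLinearMap.proj (R := ℝ) (φ := fun _ : Fin (N + 1) => Space) j.succ -
      ContinuousLinearMap.proj (R := ℝ) (φ := fun _ : Fin (N + 1) => Space) 0) with hA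
  have hAX : ∀ Y : Config (N + 1), (A Y : Config N) = fun j => Y j.succ - Y 0 := fun Y => rfl
  have hAu : A (Pi.single j.succ u) = Pi.single j u := by
    rw [hAX]
    funext i
    rw [Pi.single_eq_of_ne' (Fin.succ_ne_zero j), sub_zero]
    simp only [Pi.single_apply, Fin.succ_inj]
  have h : HasFDerivAt (fun Y : Config (N + 1) => c * f (A Y))
      (c • (fderiv ℝ f (A X)).comp A) X :=
    ((hf (A X)).hasFDerivAt.comp X A.hasFDerivAt).const_mul c
  simp only [hAX] at h
  rw [h.fderiv, smul_apply, ContinuousLinearMap.comp_apply, hAu, smul_eq_mul]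

/-- Bath kinetic density of the lift: `∑ⱼ |∇_{j+1}(c f ∘ A)(X)|² = ‖c‖² |∇f|²(A X)`. [folklore] -/
private theorem sum_gradSqAt_succ_relLift {f : Config N → ℂ} (hf : Differentiable ℝ f) (c : ℂ)
    (X : Config (N + 1)) :
    ∑ j : Fin N, ∑ k : Fin 3, (‖fderiv ℝ (fun X : Config (N + 1) => c * f (fun j => X j.succ - X 0))
        X (Pi.single j.succ (EuclideanSpace.single k (1 : ℝ)))‖₊ : ℝ≥0∞) ^ 2 =
      (‖c‖₊ : ℝ≥0∞) ^ 2 * kineticDensity f (fun j => X j.succ - X 0) := by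
  rw [kineticDensity, Finset.mul_sum]
  refine Finset.sum_congr rfl fun j _ => ?_
  rw [Finset.mul_sum]
  refine Finset.sum_congr rfl fun k _ => ?_
  rw [fderiv_relLift_single_succ hf, nnnorm_mul, ENNReal.coe_mul, mul_pow]

/-- `c (K + P n + I n) ≤ (T + c K) + (I + P)(c n)` in `ℝ≥0∞` (drop `T ≥ 0`). [folklore] -/
private theorem mul_add_le_aux (c K P I n T : ℝ≥0∞) :
    c * (K + P * n + I * n) ≤ T + c * K + (I + P) * (c * n) := by
  calc c * (K + P * n + I * n) = c * K + (I + P) * (c * n) := by ring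
    _ ≤ T + c * K + (I + P) * (c * n) := add_le_add le_add_self le_rfl

/-- **Pointwise energy density of a lift, from below.** If `ψ(X) = c Φ(Z)`, `Z = (x₁ - x₀, …)`:
`‖c‖² (|∇Φ|² + (∑_{i<j} v^per(zᵢ - zⱼ) + ∑ⱼ v^per(zⱼ))|Φ|²)(Z) ≤ (κ|∇₀ψ|² + ∑_{j≥1}|∇ⱼψ|² +
(∑ⱼ v^per(xⱼ - x₀) + ∑_{i<j} v^per(xᵢ - xⱼ))|ψ|²)(X)` (bath gradients agree, the potentials only
see differences, `κ|∇₀ψ|² ≥ 0` is dropped). [folklore] -/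
private theorem integrand_relLift_ge {v : ℝ → ℝ≥0∞} (κ : ℝ) (Φ : PeriodicTrialState N L) (c : ℂ)
    {ψ : Config (N + 1) → ℂ} (hψ : ψ = fun X => c * Φ.ψ (fun j => X j.succ - X 0))
    (X : Config (N + 1)) :
    (‖c‖₊ : ℝ≥0∞) ^ 2 * (kineticDensity Φ.ψ (fun j => X j.succ - X 0) +
        periodicInteraction v L (fun j => X j.succ - X 0) *
            (‖Φ.ψ (fun j => X j.succ - X 0)‖₊ : ℝ≥0∞) ^ 2 +
          impurityInteraction v L 0 (fun j => X j.succ - X 0) *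
            (‖Φ.ψ (fun j => X j.succ - X 0)‖₊ : ℝ≥0∞) ^ 2) ≤
      taggedKineticDensity κ ψ X + taggedInteraction v L X * (‖ψ X‖₊ : ℝ≥0∞) ^ 2 := by
  subst hψ
  have hd : Differentiable ℝ Φ.ψ := Φ.contDiff.differentiable one_ne_zero
  -- potential part: the bath configuration is `Z + x₀𝟙`, the scatterer sits at `0 + x₀`
  have htail : Matrix.vecTail X = (fun j : Fin N => X j.succ - X 0) + fun _ => X 0 := by
    funext j
    simp only [Matrix.vecTail, Function.comp_apply, Pi.add_apply, sub_add_cancel]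
  have hpot : taggedInteraction v L X = impurityInteraction v L 0 (fun j => X j.succ - X 0) +
      periodicInteraction v L (fun j => X j.succ - X 0) := by
    rw [taggedInteraction_eq, htail, periodicInteraction_add_const,
      ← impurityInteraction_add_const v L 0 _ (X 0), zero_add]
  rw [taggedKineticDensity_def, sum_gradSqAt_succ_relLift hd c X, hpot]
  simp only [nnnorm_mul, ENNReal.coe_mul, mul_pow]
  exact mul_add_le_aux _ _ _ _ _ _

/-- **Energy of the descent**: for measurable `v`, any `κ`, a tagged state `Ψ` of total momentum
`0` and its bath function `Φ`, `impurityPeriodicEnergy v 0 Φ ≤ taggedPeriodicEnergy v κ Ψ` — Tonelli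
with the tagged coordinate outermost; every slice `x₀ = x` carries at least `L⁻³ ⟨Φ, H_imp Φ⟩`
(pointwise bound at `Ψ = (√(L³))⁻¹ Φ(Y - x𝟙)`, shift of the fundamental cell). [folklore] -/
theorem impurityPeriodicEnergy_descent_le {v : ℝ → ℝ≥0∞} (hv : Measurable v) (κ : ℝ)
    (Ψ : TaggedPeriodicTrialState N L) (hQ : HasTotalMomentum 0 Ψ.ψ) {Φ : PeriodicTrialState N L}
    (hΦ : Φ.ψ = fun Z => ((Real.sqrt (L ^ 3) : ℝ) : ℂ) * Ψ.ψ (Matrix.vecCons 0 Z)) :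
    impurityPeriodicEnergy v 0 Φ ≤ taggedPeriodicEnergy v κ Ψ := by
  have hL := Ψ.side_pos
  have hL3 : ENNReal.ofReal L ^ 3 ≠ 0 := pow_ne_zero _ (ENNReal.ofReal_pos.2 hL).ne'
  have hL3' : ENNReal.ofReal L ^ 3 ≠ ⊤ := ENNReal.pow_ne_top ENNReal.ofReal_ne_top
  have hΨ := eq_lift_of_hasTotalMomentum_zero Ψ hQ hΦ
  set D : Config N → ℝ≥0∞ := fun Z => kineticDensity Φ.ψ Z +
    periodicInteraction v L Z * (‖Φ.ψ Z‖₊ : ℝ≥0∞) ^ 2 +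
      impurityInteraction v L 0 Z * (‖Φ.ψ Z‖₊ : ℝ≥0∞) ^ 2 with hD
  have hDper : ∀ (Z : Config N) (i : Fin N) (k : Fin 3),
      (‖((Real.sqrt (L ^ 3))⁻¹ : ℂ)‖₊ : ℝ≥0∞) ^ 2 *
          D (Z + Pi.single i (EuclideanSpace.single k L)) =
        (‖((Real.sqrt (L ^ 3))⁻¹ : ℂ)‖₊ : ℝ≥0∞) ^ 2 * D Z := fun Z i k => by
    simp only [hD, Φ.kineticDensity_add_single, periodicInteraction_add_single,
      impurityInteraction_add_single, Φ.periodic]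
  have hmeas : Measurable fun X => taggedKineticDensity κ Ψ.ψ X +
      taggedInteraction v L X * (‖Ψ.ψ X‖₊ : ℝ≥0∞) ^ 2 :=
    (measurable_taggedKineticDensity κ _).add ((measurable_taggedInteraction hv L).mul
      ((Ψ.contDiff.continuous.measurable.nnnorm.coe_nnreal_ennreal).pow_const _))
  rw [taggedPeriodicEnergy_def, setLIntegral_cellN_succ_left hmeas]
  -- every slice `x₀ = x` carries at least `L⁻³ ⟨Φ, (H + ∑ⱼ v^per(xⱼ)) Φ⟩`
  have hslice : ∀ x : Space, (ENNReal.ofReal L ^ 3)⁻¹ * impurityPeriodicEnergy v 0 Φ ≤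
      ∫⁻ Y in cellN N L, (taggedKineticDensity κ Ψ.ψ (Matrix.vecCons x Y) +
        taggedInteraction v L (Matrix.vecCons x Y) *
          (‖Ψ.ψ (Matrix.vecCons x Y)‖₊ : ℝ≥0∞) ^ 2) := by
    intro x
    calc (ENNReal.ofReal L ^ 3)⁻¹ * impurityPeriodicEnergy v 0 Φ
        ≤ (ENNReal.ofReal L ^ 3)⁻¹ * ∫⁻ Z in cellN N L, D Z := by
          rw [impurityPeriodicEnergy_eq, periodicEnergy]
          exact mul_le_mul_right (le_lintegral_add _ _) _
      _ = ∫⁻ Y in cellN N L,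
            (‖((Real.sqrt (L ^ 3))⁻¹ : ℂ)‖₊ : ℝ≥0∞) ^ 2 * D (Y + fun _ => -x) := by
          rw [lintegral_cellN_comp_add hL (G := fun Z => (‖((Real.sqrt (L ^ 3))⁻¹ : ℂ)‖₊ :
              ℝ≥0∞) ^ 2 * D Z) hDper (fun _ => -x),
            lintegral_const_mul' _ _ (ENNReal.pow_ne_top ENNReal.coe_ne_top),
            nnnorm_constantMode_sq hL]
      _ ≤ _ := lintegral_mono fun Y => ?_
    have hA : (fun j => (Matrix.vecCons x Y : Config (N + 1)) j.succ -
        (Matrix.vecCons x Y : Config (N + 1)) 0) = Y + fun _ => -x := funext fun j => by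
      simp only [Matrix.cons_val_succ, Matrix.cons_val_zero, Pi.add_apply, sub_eq_add_neg]
    have h := integrand_relLift_ge (v := v) κ Φ _ hΨ (Matrix.vecCons x Y)
    rw [hA] at h
    exact h
  calc impurityPeriodicEnergy v 0 Φ
      = ∫⁻ _ in cell L, (ENNReal.ofReal L ^ 3)⁻¹ * impurityPeriodicEnergy v 0 Φ := by
        rw [setLIntegral_const, volume_cell, mul_right_comm, ENNReal.inv_mul_cancel hL3 hL3',
          one_mul]
    _ ≤ _ := lintegral_mono hslice

/-- **Occupation identity of the descent**: for a tagged state `Ψ` of total momentum `0` and its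
bath function `Φ`, `∫_{[0,L)^{3N}} |∫_{[0,L)³} Φ(X + t𝟙) dt|² dX = L⁶ · taggedZeroModeOccupation Ψ`:
slice by slice `Φ(X + t𝟙) = √(L³) Ψ(-t, X)` (zero momentum) and `∫ Ψ(-t, X) dt = ∫ Ψ(t, X) dt`
over the cell (reflection invariance, `t ↦ Ψ(t, X)` is `Lℤ³`-periodic). [folklore] -/
theorem lintegral_sq_setIntegral_descent (Ψ : TaggedPeriodicTrialState N L)
    (hQ : HasTotalMomentum 0 Ψ.ψ) {Φ : PeriodicTrialState N L}
    (hΦ : Φ.ψ = fun Z => ((Real.sqrt (L ^ 3) : ℝ) : ℂ) * Ψ.ψ (Matrix.vecCons 0 Z)) :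
    ∫⁻ X in cellN N L, (‖∫ t in cell L, Φ.ψ (X + fun _ => t)‖₊ : ℝ≥0∞) ^ 2 =
      ENNReal.ofReal (L ^ 6) * taggedZeroModeOccupation N L Ψ.ψ := by
  have hL := Ψ.side_pos
  have hL3 : ENNReal.ofReal L ^ 3 ≠ 0 := pow_ne_zero _ (ENNReal.ofReal_pos.2 hL).ne'
  have hL3' : ENNReal.ofReal L ^ 3 ≠ ⊤ := ENNReal.pow_ne_top ENNReal.ofReal_ne_top
  have hslice : ∀ X : Config N, ∫ t in cell L, Φ.ψ (X + fun _ => t) =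
      ((Real.sqrt (L ^ 3) : ℝ) : ℂ) * ∫ t in cell L, Ψ.ψ (Matrix.vecCons t X) := by
    intro X
    have hz : ∀ t : Space, Ψ.ψ (Matrix.vecCons 0 (X + fun _ => t)) = Ψ.ψ (Matrix.vecCons (-t) X) :=
      fun t => by rw [apply_vecCons_eq hQ (-t) X, neg_neg]
    simp only [hΦ, hz]
    rw [integral_const_mul]
    exact congrArg _ (setIntegral_cell_comp_neg hL (f := fun t => Ψ.ψ (Matrix.vecCons t X))
      fun t k => by
        have h : (Matrix.vecCons t X : Config (N + 1)) +
            Pi.single (0 : Fin (N + 1)) (EuclideanSpace.single k L : Space) =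
              Matrix.vecCons (t + EuclideanSpace.single k L) X := by
          funext i
          refine Fin.cases ?_ (fun l => ?_) i
          · simp only [Pi.add_apply, Matrix.cons_val_zero, Pi.single_eq_same]
          · simp only [Pi.add_apply, Matrix.cons_val_succ,
              Pi.single_eq_of_ne (Fin.succ_ne_zero l), add_zero]
        show Ψ.ψ (Matrix.vecCons (t + EuclideanSpace.single k L) X) = Ψ.ψ (Matrix.vecCons t X)
        rw [← h, Ψ.periodic])
  have hc : ((‖((Real.sqrt (L ^ 3) : ℝ) : ℂ)‖₊ : ℝ≥0∞) ^ 2) = ENNReal.ofReal L ^ 3 := by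
    rw [coe_nnnorm_sq_eq_ofReal, Complex.norm_real, Real.norm_of_nonneg (Real.sqrt_nonneg _),
      Real.sq_sqrt (pow_pos hL 3).le, ENNReal.ofReal_pow hL.le]
  have h6 : ENNReal.ofReal (L ^ 6) = ENNReal.ofReal L ^ 3 * ENNReal.ofReal L ^ 3 := by
    rw [ENNReal.ofReal_pow hL.le, ← pow_add]
  simp_rw [hslice, nnnorm_mul, ENNReal.coe_mul, mul_pow, hc]
  rw [lintegral_const_mul' _ _ hL3', taggedZeroModeOccupation_def, h6, mul_assoc,
    ← mul_assoc (ENNReal.ofReal L ^ 3) (ENNReal.ofReal L ^ 3)⁻¹, ENNReal.mul_inv_cancel hL3 hL3',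
    one_mul]

/-- **Stub `stub_zeroMomentumDescent` of crux `RecoilTransfer` (route `BECProbeMassFlow`), exact
registered signature: the zero-momentum descent.** For measurable `v ≥ 0`, any `N`, `L`, `κ` and any
tagged trial state `Ψ` of total momentum `0`, the bath function `Φ(Z) = √(L³) Ψ(0, Z)` is an
admissible pinned-scatterer trial state with `⟨Φ, (H + ∑ⱼ v^per(xⱼ)) Φ⟩ ≤ ⟨Ψ, H_κ Ψ⟩` and
`∫_{[0,L)^{3N}} |∫_{[0,L)³} Φ(X + t𝟙) dt|² dX ≤ L⁶ · taggedZeroModeOccupation N L Ψ` (in fact `=`).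
[folklore] -/
theorem stub_zeroMomentumDescent :
    ∀ v : ℝ → ℝ≥0∞, Measurable v → ∀ (N : ℕ) (L : ℝ) (κ : ℝ),
      ∀ Ψ : TaggedPeriodicTrialState N L, HasTotalMomentum 0 Ψ.ψ →
        ∃ Φ : PeriodicTrialState N L,
          impurityPeriodicEnergy v 0 Φ ≤ taggedPeriodicEnergy v κ Ψ ∧
          ∫⁻ X in cellN N L, (‖∫ t in cell L, Φ.ψ (X + fun _ => t)‖₊ : ℝ≥0∞) ^ 2 ≤
            ENNReal.ofReal (L ^ 6) * taggedZeroModeOccupation N L Ψ.ψ := by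
  intro v hv N L κ Ψ hQ
  obtain ⟨Φ, hΦ⟩ := zeroMomentumDescent_exists Ψ hQ
  exact ⟨Φ, impurityPeriodicEnergy_descent_le hv κ Ψ hQ hΦ,
    (lintegral_sq_setIntegral_descent Ψ hQ hΦ).le⟩

end Summit.AtomisticToContinuum.BoseEinsteinCondensation.Theorems

end
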